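import Literature.Computability.Cryptography.ImpagliazzoLevinRound
import Literature.Computability.Cryptography.ImpagliazzoLevinAnalysis
import Literature.Computability.Complexity.IterateFPPoly
import HarnessLib

/-!
# Impagliazzo–Levin inversion, VI: the inverter is PPT; Bogdanov–Trevisan's Theorem 22

The second efficiency statement of `ImpagliazzoLevinAnalysis.lean` — the inverter `Params.inv` of
`ImpagliazzoLevinOWF.lean` is a probabilistic polynomial-time algorithm (`inv_isPPT`) — and, with
`Rel_mem_P` (`ImpagliazzoLevinVerifier.lean`), the unconditional form of Bogdanov–Trevisan's
Theorem 22 / crypto-foundations.S25: **`(NP, U) ⊆ HeurBPP` excludes one-way functions**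
(`not_isOneWay_of_NP_uniform_subset_HeurBPP`, `OWFExist_imp_not_subset_HeurBPP`).

The run function `Params.run` (try all rounds `j < rounds(n)`, output the first round candidate
that `f` maps to `y`) is again a single clocked loop of `FP` bricks (`iterate_mem_FP_of_growth_poly`)
over the rounds, whose body decodes `(b, κ') = (j mod (n+3), j / (n+3))` in unary, cuts the round
segment of the coins, calls the round function `candFn` of `ImpagliazzoLevinRound.lean`, tests the
candidate with `f`, and records the first hit (`obody`, `obody_st0`, `iterate_obody`,
`length_obody_le`, `runFn_boolPair`, `runFn_mem_FP`).

## References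

* A. Bogdanov, L. Trevisan, *Average-Case Complexity*, ECCC TR06-073 (2006) = Found. Trends TCS
  2(1) (2006): Thm. 22 (§3.3), Claim 28 ("`A` … runs in time polynomial in `n` and `1/δ`").
* R. Impagliazzo, L. Levin, FOCS 1990, §4.
* S. Arora, B. Barak, *Computational Complexity: A Modern Approach*, CUP 2009, §1.3, §1.4.1, §7.1.
-/

namespace Literature.Computability.Cryptography

namespace ImpagliazzoLevin

open _root_.Computability Polynomial Complexity Complexity.Nondeterministic Complexity.Plumb Complexity.Brick
  Complexity.OracleCompose Complexity.HashBricks MetaComplexity AffineStr AffineProg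

namespace Params

variable (P : Params) (Ad : Adv)

/-! ### The run loop: state `⟨x₀, ⟨1ʲ, ⟨fl, ans⟩⟩⟩`, `x₀ = ⟨1ⁿ, ⟨y, r⟩⟩` -/

/-- The data of the run. [folklore] -/
def x0 (n : ℕ) (y r : List Bool) : List Bool := boolPair (ones n) (boolPair y r)

/-- The loop state. [folklore] -/
def st0 (n : ℕ) (y r : List Bool) (j : ℕ) (fl ans : List Bool) : List Bool :=
  boolPair (x0 n y r) (boolPair (ones j) (boolPair fl ans))

/-- `1ⁿ`. [folklore] -/
noncomputable def uN0 : List Bool → List Bool := fstF ∘ fstF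
/-- `y`. [folklore] -/
noncomputable def yF0 : List Bool → List Bool := nthF 1 ∘ fstF
/-- `r`. [folklore] -/
noncomputable def rF0 : List Bool → List Bool := sndPow 1 ∘ fstF
/-- `1ʲ` (normalised to ones). [folklore] -/
noncomputable def jF0 : List Bool → List Bool := onesFn ∘ nthF 1
/-- `fl`. [folklore] -/
noncomputable def flF : List Bool → List Bool := nthF 2
/-- `ans`. [folklore] -/
noncomputable def ansF : List Bool → List Bool := sndPow 2
/-- `⟨1^{j/(n+3)}, 1^{j mod (n+3)}⟩`. [folklore] -/
noncomputable def dm0 : List Bool → List Bool := divModFn ∘ fanoutFn (polyFn (X + 3) ∘ uN0) jF0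
/-- The level `1ᵇ`, `b = j mod (n+3)`. [folklore] -/
noncomputable def bF0 : List Bool → List Bool := sndF ∘ dm0
/-- The coin length `1^{κ'}`, `κ' = min (j / (n+3)) Q(n)` (the cap is void on the rounds `j < rounds(n)`
and bounds the state on every word). [folklore] -/
noncomputable def kF0 : List Bool → List Bool := takeFn ∘ fanoutFn (polyFn (P.QPoly Ad) ∘ uN0) (fstF ∘ dm0)
/-- `1^{R(n)}`. [folklore] -/
noncomputable def rnF0 : List Bool → List Bool := polyFn (P.RnPoly Ad) ∘ uN0
/-- The round segment `seg R(n) j r`. [folklore] -/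
noncomputable def sdF0 : List Bool → List Bool :=
  takeFn ∘ fanoutFn (P.rnF0 Ad) (dropFn ∘ fanoutFn (umulFn ∘ fanoutFn jF0 (P.rnF0 Ad)) rF0)
/-- The round data `x₁`. [folklore] -/
noncomputable def x1F : List Bool → List Bool := fanoutFn uN0 (fanoutFn bF0 (fanoutFn (P.kF0 Ad) (fanoutFn yF0 (P.sdF0 Ad))))
/-- The round candidate. [folklore] -/
noncomputable def candF0 : List Bool → List Bool := P.candFn Ad ∘ P.x1F Ad
/-- The hit test `[f cand = y]`. [folklore] -/
noncomputable def hitF : List Bool → List Bool := eqPairFn ∘ fanoutFn (P.f ∘ P.candF0 Ad) yF0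
/-- The guard `[j < rounds(n)] ∧ [fl = ε]`. [folklore] -/
noncomputable def guard0 : List Bool → List Bool :=
  andFn (lenLeFn X ∘ fanoutFn (polyFn (P.roundsPoly Ad) ∘ uN0) (List.cons true ∘ jF0)) (isNilFn ∘ flF)
/-- The new flag. [folklore] -/
noncomputable def flNew : List Bool → List Bool := iteFn (P.guard0 Ad) (iteFn (P.hitF Ad) (fun _ => [true]) flF) flF
/-- The new answer. [folklore] -/
noncomputable def ansNew : List Bool → List Bool := iteFn (P.guard0 Ad) (iteFn (P.hitF Ad) (P.candF0 Ad) ansF) ansF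
/-- **One round = one round of the loop.** [Bogdanov–Trevisan 2006, Claim 28] [folklore] -/
noncomputable def obody : List Bool → List Bool :=
  fanoutFn fstF (fanoutFn (List.cons true ∘ jF0) (fanoutFn (P.flNew Ad) (P.ansNew Ad)))
/-- The initial state from the machine input `⟨⟨u, y⟩, r⟩`. [folklore] -/
noncomputable def init0F : List Bool → List Bool :=
  fanoutFn (fanoutFn (onesFn ∘ fstF ∘ fstF) (fanoutFn (sndF ∘ fstF) sndF)) (fun _ => boolPair [] (boolPair [] []))
/-- **The run function as a string function**: `rounds(|x₀|)` rounds of the loop, then the answer.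
[Bogdanov–Trevisan 2006, Claim 28] [folklore] -/
noncomputable def runFn : List Bool → List Bool :=
  ansF ∘ (fun S => (P.obody Ad)^[(P.roundsPoly Ad).eval (boolUnpair S).1.length] S) ∘ init0F

/-- The model of one round of the loop on `(fl, ans)`. [folklore] -/
def ostep (n : ℕ) (y r : List Bool) (j : ℕ) (q : List Bool × List Bool) : List Bool × List Bool :=
  if j < P.rounds Ad n ∧ q.1 = [] then
    if P.f (P.cand Ad n (j % (n + 3)) (min (P.Q Ad n) (j / (n + 3))) y (seg (P.Rn Ad n) j r)) = y then
      ([true], P.cand Ad n (j % (n + 3)) (min (P.Q Ad n) (j / (n + 3))) y (seg (P.Rn Ad n) j r))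
    else q
  else q

/-- The first hit among the rounds `< k`. [folklore] -/
def firstHit (n : ℕ) (y r : List Bool) (k : ℕ) : Option ℕ := (List.range k).find? fun j => P.f (P.roundOut Ad n j y r) == y

/-- The model of the loop after `k` rounds. [folklore] -/
def oloop (n : ℕ) (y r : List Bool) : ℕ → List Bool × List Bool
  | 0 => ([], [])
  | k + 1 => P.ostep Ad n y r k (oloop n y r k)

/-- The size of the round data on every word: a polynomial in `|x₀|`. [folklore] -/
noncomputable def x1Poly : Polynomial ℕ := 6 * X + 14 + 2 * P.QPoly Ad + P.RnPoly Ad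

/-- The growth polynomial of a round of the run loop. [folklore] -/
noncomputable def oGrowth : Polynomial ℕ := 10 + 128 * P.x1Poly Ad ^ 2

/-! #### Values on well-formed states -/

section Values

variable {P Ad}
variable (n : ℕ) (y r : List Bool) (j : ℕ) (fl ans : List Bool)

/-- Reading `1ⁿ`. [folklore] -/
@[simp] theorem uN0_st0 : uN0 (st0 n y r j fl ans) = ones n := by simp [uN0, st0, x0]
/-- Reading `y`. [folklore] -/
@[simp] theorem yF0_st0 : yF0 (st0 n y r j fl ans) = y := by simp [yF0, st0, x0]
/-- Reading `r`. [folklore] -/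
@[simp] theorem rF0_st0 : rF0 (st0 n y r j fl ans) = r := by simp [rF0, st0, x0, sndPow]
/-- Reading `1ʲ`. [folklore] -/
@[simp] theorem jF0_st0 : jF0 (st0 n y r j fl ans) = ones j := by simp [jF0, st0, onesFn, unaryEncodeNat_eq_ones]
/-- Reading `fl`. [folklore] -/
@[simp] theorem flF_st0 : flF (st0 n y r j fl ans) = fl := by simp [flF, st0]
/-- Reading `ans`. [folklore] -/
@[simp] theorem ansF_st0 : ansF (st0 n y r j fl ans) = ans := by simp [ansF, st0, sndPow]
/-- `⟨1^{j/(n+3)}, 1^{j mod (n+3)}⟩`. [folklore] -/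
@[simp] theorem dm0_st0 : dm0 (st0 n y r j fl ans) = boolPair (ones (j / (n + 3))) (ones (j % (n + 3))) := by
  simp [dm0, polyFn_apply]
/-- The level. [folklore] -/
@[simp] theorem bF0_st0 : bF0 (st0 n y r j fl ans) = ones (j % (n + 3)) := by simp [bF0]
/-- The capped coin length. [folklore] -/
@[simp] theorem kF0_st0 : P.kF0 Ad (st0 n y r j fl ans) = ones (min (P.Q Ad n) (j / (n + 3))) := by
  simp [kF0, polyFn_apply, ones, List.take_replicate]
/-- The round segment. [folklore] -/
@[simp] theorem sdF0_st0 : P.sdF0 Ad (st0 n y r j fl ans) = seg (P.Rn Ad n) j r := by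
  simp [sdF0, rnF0, polyFn_apply, seg]
/-- The round data. [folklore] -/
@[simp] theorem x1F_st0 : P.x1F Ad (st0 n y r j fl ans) = x1 n (j % (n + 3)) (min (P.Q Ad n) (j / (n + 3))) y (seg (P.Rn Ad n) j r) := by
  simp [x1F, x1]
/-- **The round candidate.** [folklore] -/
@[simp] theorem candF0_st0 : P.candF0 Ad (st0 n y r j fl ans) =
    P.cand Ad n (j % (n + 3)) (min (P.Q Ad n) (j / (n + 3))) y (seg (P.Rn Ad n) j r) := by
  simp [candF0, candFn_x1]
/-- The hit test. [folklore] -/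
@[simp] theorem hitF_st0 : P.hitF Ad (st0 n y r j fl ans) =
    [decide (P.f (P.cand Ad n (j % (n + 3)) (min (P.Q Ad n) (j / (n + 3))) y (seg (P.Rn Ad n) j r)) = y)] := by
  simp [hitF, eqPairFn_boolPair]
/-- The guard. [folklore] -/
@[simp] theorem guard0_st0 : P.guard0 Ad (st0 n y r j fl ans) = [decide (j < P.rounds Ad n) && decide (fl = [])] := by
  rw [guard0, andFn_apply (b := decide (j < P.rounds Ad n)) (b' := decide (fl = []))]
  · simp [lenLeFn_boolPair, polyFn_apply]
  · simp [isNilFn]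

/-- **One round on a well-formed state.** [folklore] -/
theorem obody_st0 : P.obody Ad (st0 n y r j fl ans) =
    st0 n y r (j + 1) (P.ostep Ad n y r j (fl, ans)).1 (P.ostep Ad n y r j (fl, ans)).2 := by
  have hg := guard0_st0 (P := P) (Ad := Ad) n y r j fl ans
  have hh := hitF_st0 (P := P) (Ad := Ad) n y r j fl ans
  have hfl : P.flNew Ad (st0 n y r j fl ans) = (P.ostep Ad n y r j (fl, ans)).1 := by
    rw [flNew, iteFn_apply hg]
    unfold ostep
    by_cases h1 : j < P.rounds Ad n ∧ fl = []
    · rw [if_pos h1, show (decide (j < P.rounds Ad n) && decide (fl = [])) = true by simp [h1.1, h1.2], if_pos rfl,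
        iteFn_apply hh]
      split_ifs <;> simp_all
    · rw [if_neg h1, show (decide (j < P.rounds Ad n) && decide (fl = [])) = false by simpa [not_and_or] using h1]
      simp
  have hans : P.ansNew Ad (st0 n y r j fl ans) = (P.ostep Ad n y r j (fl, ans)).2 := by
    rw [ansNew, iteFn_apply hg]
    unfold ostep
    by_cases h1 : j < P.rounds Ad n ∧ fl = []
    · rw [if_pos h1, show (decide (j < P.rounds Ad n) && decide (fl = [])) = true by simp [h1.1, h1.2], if_pos rfl,
        iteFn_apply hh]
      split_ifs <;> simp_all
    · rw [if_neg h1, show (decide (j < P.rounds Ad n) && decide (fl = [])) = false by simpa [not_and_or] using h1]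
      simp
  simp only [obody, fanoutFn_apply, Function.comp_apply, hfl, hans, jF0_st0]
  simp [st0, ones, List.replicate_succ]

end Values

/-! #### Semantics of the loop -/

section Semantics

variable {P Ad}
variable (n : ℕ) (y r : List Bool)

/-- **The rounds iterate the model.** [folklore] -/
theorem iterate_obody : ∀ k : ℕ,
    (P.obody Ad)^[k] (st0 n y r 0 [] []) = st0 n y r k (P.oloop Ad n y r k).1 (P.oloop Ad n y r k).2
  | 0 => rfl
  | k + 1 => by rw [Function.iterate_succ_apply', iterate_obody k, obody_st0]; rfl

/-- On the rounds `j < rounds(n)` the cap on the coin length is void: `min Q(n) (j/(n+3)) = j/(n+3)`.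
[folklore] -/
theorem min_Q_eq {j : ℕ} (hj : j < P.rounds Ad n) : min (P.Q Ad n) (j / (n + 3)) = j / (n + 3) := by
  refine Nat.min_eq_right (Nat.lt_succ_iff.1 ?_)
  rw [Nat.div_lt_iff_lt_mul (by omega)]
  unfold rounds at hj
  linarith [Nat.mul_comm (n + 3) (P.Q Ad n + 1)]

/-- **The model is the specification**: after `k` rounds the state records the first hit among the
rounds `< min k rounds(n)`. [Bogdanov–Trevisan 2006, Claim 28] [folklore] -/
theorem oloop_eq : ∀ k : ℕ, P.oloop Ad n y r k =
    (match P.firstHit Ad n y r (min k (P.rounds Ad n)) with | some _ => [true] | none => [],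
     match P.firstHit Ad n y r (min k (P.rounds Ad n)) with | some j => P.roundOut Ad n j y r | none => [])
  | 0 => by simp [oloop, firstHit]
  | k + 1 => by
    rw [oloop, oloop_eq k]
    by_cases hk : k < P.rounds Ad n
    · rw [Nat.min_eq_left hk.le, Nat.min_eq_left hk]
      have hsplit : P.firstHit Ad n y r (k + 1) =
          (P.firstHit Ad n y r k).or ([k].find? fun j => P.f (P.roundOut Ad n j y r) == y) := by
        unfold firstHit; rw [List.range_succ, List.find?_append]
      have hcand : P.cand Ad n (k % (n + 3)) (min (P.Q Ad n) (k / (n + 3))) y (seg (P.Rn Ad n) k r) = P.roundOut Ad n k y r := by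
        rw [min_Q_eq (P := P) (Ad := Ad) n hk]; rfl
      cases hfh : P.firstHit Ad n y r k with
      | none =>
        rw [hsplit, hfh, Option.none_or]
        unfold ostep
        simp only
        rw [if_pos ⟨hk, trivial⟩, hcand]
        by_cases hhit : P.f (P.roundOut Ad n k y r) = y
        · rw [if_pos hhit, show ([k].find? fun j => P.f (P.roundOut Ad n j y r) == y) = some k by simp [hhit]]
        · rw [if_neg hhit, show ([k].find? fun j => P.f (P.roundOut Ad n j y r) == y) = none by simp [hhit]]
      | some j₀ =>
        rw [hsplit, hfh, Option.some_or]
        unfold ostep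
        simp
    · rw [Nat.min_eq_right (not_lt.1 hk), Nat.min_eq_right (by omega)]
      unfold ostep
      rw [if_neg (fun h => hk h.1)]

/-- The initial state. [folklore] -/
theorem init0F_boolPair (inp : List Bool) :
    init0F (boolPair inp r) = st0 (boolUnpair inp).1.length (boolUnpair inp).2 r 0 [] [] := by
  simp [init0F, st0, x0, fstF, sndF, onesFn, unaryEncodeNat_eq_ones, ones]

/-- **The string function is the run function**: `runFn ⟨inp, r⟩ = run inp r`. [Bogdanov–Trevisan
2006, Claim 28] [folklore] -/
theorem runFn_boolPair (inp : List Bool) : P.runFn Ad (boolPair inp r) = P.run Ad inp r := by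
  set n := (boolUnpair inp).1.length with hn
  set y := (boolUnpair inp).2 with hy
  have hK : P.rounds Ad n ≤ (P.roundsPoly Ad).eval (boolUnpair (st0 n y r 0 [] [])).1.length := by
    rw [st0, boolUnpair_boolPair, ← eval_roundsPoly]
    refine TM2Iter.eval_mono _ ?_
    simp [x0]; omega
  simp only [runFn, Function.comp_apply, init0F_boolPair, ← hn, ← hy]
  rw [iterate_obody, ansF_st0, oloop_eq, Nat.min_eq_right hK]
  rfl

end Semantics

/-! #### Growth on every word -/

section Growth

variable {P Ad}

/-- The bits of a run state: after one more run they are the new bits. [folklore] -/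
theorem bitsF_rbody (S : List Bool) : bitsF (P.rbody Ad S) = P.bitsNew Ad S := by simp [bitsF, rbody, sndPow]

/-- The bits grow by at most one per run. [folklore] -/
theorem length_bitsF_iterate_rbody_le (S : List Bool) : ∀ k : ℕ, (bitsF ((P.rbody Ad)^[k] S)).length ≤ (bitsF S).length + k
  | 0 => by simp
  | k + 1 => by
    rw [Function.iterate_succ_apply', bitsF_rbody]
    have := length_bitsNew_le (P := P) (Ad := Ad) ((P.rbody Ad)^[k] S)
    have := length_bitsF_iterate_rbody_le S k
    omega

/-- **The round candidate is never longer than the number of runs**: `|candFn x| ≤ 128 |x|²` on every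
word. [folklore] -/
theorem length_candFn_le (x : List Bool) : (P.candFn Ad x).length ≤ (128 * X ^ 2 : Polynomial ℕ).eval x.length := by
  have h := length_bitsF_iterate_rbody_le (P := P) (Ad := Ad) (init1F x) ((128 * X ^ 2 : Polynomial ℕ).eval x.length)
  have h0 : bitsF (init1F x) = [] := by simp [bitsF, init1F, sndPow]
  have hx : (boolUnpair (init1F x)).1 = x := by simp [init1F]
  simp only [candFn, Function.comp_apply, hx]
  rw [h0] at h
  simpa using h

/-- `guard0` is one-bit. [folklore] -/
theorem oneBit_guard0 : OneBit (P.guard0 Ad) := oneBit_andFn ((oneBit_lenLeFn X).comp _) (oneBit_isNilFn.comp _)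
/-- `hitF` is one-bit. [folklore] -/
theorem oneBit_hitF : OneBit (P.hitF Ad) := oneBit_eqPairFn.comp _

/-- **The round data is polynomially bounded by the run data**, on every word: `|x1F S| ≤ x1Poly(|fstF S|)`
(the level is a remainder `mod (n+3)`, the coin length is capped by `Q`, the segment by `R`). [folklore] -/
theorem length_x1F_le (S : List Bool) : (P.x1F Ad S).length ≤ (P.x1Poly Ad).eval (fstF S).length := by
  set F := (fstF S).length with hF
  have h0 := length_fstF_sndF_le (fstF S)
  have h1 := length_fstF_sndF_le (sndF (fstF S))
  have eN : uN0 S = fstF (fstF S) := rfl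
  have ey : yF0 S = fstF (sndF (fstF S)) := rfl
  -- the level: a remainder
  have hdm : dm0 S = boolPair (ones ((nthF 1 S).length / ((uN0 S).length + 3))) (ones ((nthF 1 S).length % ((uN0 S).length + 3))) := by
    simp [dm0, polyFn_apply, jF0, onesFn, unaryEncodeNat_eq_ones]
  have hb : (bF0 S).length < (uN0 S).length + 3 := by
    simp only [bF0, Function.comp_apply, hdm, sndF_boolPair, List.length_replicate]
    exact Nat.mod_lt _ (by omega)
  -- the coin length: capped by `Q`
  have hk : (P.kF0 Ad S).length ≤ (P.QPoly Ad).eval F := by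
    simp only [kF0, Function.comp_apply, fanoutFn_apply, takeFn_boolPair, List.length_take, polyFn_apply, List.length_replicate]
    exact (Nat.min_le_left _ _).trans (TM2Iter.eval_mono _ (by rw [eN]; omega))
  -- the segment: at most `R`
  have hsd : (P.sdF0 Ad S).length ≤ (P.RnPoly Ad).eval F := by
    simp only [sdF0, rnF0, Function.comp_apply, fanoutFn_apply, takeFn_boolPair, List.length_take, polyFn_apply,
      List.length_replicate]
    exact (Nat.min_le_left _ _).trans (TM2Iter.eval_mono _ (by rw [eN]; omega))
  have hN : (uN0 S).length ≤ F := by rw [eN]; omega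
  have hy : (yF0 S).length ≤ F := by rw [ey]; omega
  simp only [x1F, fanoutFn_apply, length_boolPair, x1Poly, eval_add, eval_mul, eval_ofNat, eval_X]
  omega

/-- **Polynomial growth of a round of the run loop on every word**: `|obody S| ≤ |S| + oGrowth(|fstF S|)`.
[folklore] -/
theorem length_obody_le (S : List Bool) : (P.obody Ad S).length ≤ S.length + (P.oGrowth Ad).eval (fstF S).length := by
  have h0 := length_fstF_sndF_le S
  have h1 := length_fstF_sndF_le (sndF S)
  have h2 := length_fstF_sndF_le (sndF (sndF S))
  have e1 : nthF 1 S = fstF (sndF S) := rfl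
  have e2 : flF S = fstF (sndF (sndF S)) := rfl
  have e3 : ansF S = sndF (sndF (sndF S)) := rfl
  -- the candidate is polynomially bounded
  have hcand : (P.candF0 Ad S).length ≤ (128 * P.x1Poly Ad ^ 2).eval (fstF S).length := by
    have h := length_candFn_le (P := P) (Ad := Ad) (P.x1F Ad S)
    have hx := length_x1F_le (P := P) (Ad := Ad) S
    simp only [candF0, Function.comp_apply, eval_mul, eval_ofNat, eval_pow, eval_X] at h ⊢
    exact h.trans (Nat.mul_le_mul_left _ (Nat.pow_le_pow_left hx 2))
  have hfl : (P.flNew Ad S).length ≤ (flF S).length + 1 := by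
    rw [flNew, iteFn_of_oneBit (oneBit_guard0 (P := P) (Ad := Ad))]
    split_ifs
    · rw [iteFn_of_oneBit (oneBit_hitF (P := P) (Ad := Ad))]
      split_ifs <;> simp
    · omega
  have hans : (P.ansNew Ad S).length ≤ (ansF S).length + (P.candF0 Ad S).length := by
    rw [ansNew, iteFn_of_oneBit (oneBit_guard0 (P := P) (Ad := Ad))]
    split_ifs
    · rw [iteFn_of_oneBit (oneBit_hitF (P := P) (Ad := Ad))]
      split_ifs <;> omega
    · omega
  rw [e2] at hfl
  rw [e3] at hans
  simp only [obody, fanoutFn_apply, Function.comp_apply, length_boolPair, List.length_cons, jF0, length_onesFn, e1,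
    oGrowth, eval_add, eval_ofNat] at hcand ⊢
  omega

/-- The run loop keeps the run data. [folklore] -/
theorem fst_obody (S : List Bool) : (boolUnpair (P.obody Ad S)).1 = (boolUnpair S).1 := by
  simp [obody, fstF]

end Growth

/-! #### `FP` membership, and the inverter is PPT -/

section FP

variable {P Ad}

/-- `uN0 ∈ FP`. [folklore] -/
theorem uN0_mem_FP : uN0 ∈ FP := comp_mem_FP fstF_mem_FP fstF_mem_FP
/-- `yF0 ∈ FP`. [folklore] -/
theorem yF0_mem_FP : yF0 ∈ FP := comp_mem_FP (nthF_mem_FP 1) fstF_mem_FP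
/-- `rF0 ∈ FP`. [folklore] -/
theorem rF0_mem_FP : rF0 ∈ FP := comp_mem_FP (sndPow_mem_FP 1) fstF_mem_FP
/-- `jF0 ∈ FP`. [folklore] -/
theorem jF0_mem_FP : jF0 ∈ FP := comp_mem_FP onesFn_mem_FP (nthF_mem_FP 1)
/-- `dm0 ∈ FP`. [folklore] -/
theorem dm0_mem_FP : dm0 ∈ FP :=
  comp_mem_FP divModFn_mem_FP (fanoutFn_mem_FP (comp_mem_FP (polyFn_mem_FP _) uN0_mem_FP) jF0_mem_FP)
/-- `bF0 ∈ FP`. [folklore] -/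
theorem bF0_mem_FP : bF0 ∈ FP := comp_mem_FP sndF_mem_FP dm0_mem_FP
/-- `kF0 ∈ FP`. [folklore] -/
theorem kF0_mem_FP : P.kF0 Ad ∈ FP :=
  comp_mem_FP takeFn_mem_FP (fanoutFn_mem_FP (comp_mem_FP (polyFn_mem_FP _) uN0_mem_FP) (comp_mem_FP fstF_mem_FP dm0_mem_FP))
/-- `rnF0 ∈ FP`. [folklore] -/
theorem rnF0_mem_FP : P.rnF0 Ad ∈ FP := comp_mem_FP (polyFn_mem_FP _) uN0_mem_FP
/-- `sdF0 ∈ FP`. [folklore] -/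
theorem sdF0_mem_FP : P.sdF0 Ad ∈ FP :=
  comp_mem_FP takeFn_mem_FP (fanoutFn_mem_FP rnF0_mem_FP (comp_mem_FP dropFn_mem_FP
    (fanoutFn_mem_FP (comp_mem_FP umulFn_mem_FP (fanoutFn_mem_FP jF0_mem_FP rnF0_mem_FP)) rF0_mem_FP)))
/-- `x1F ∈ FP`. [folklore] -/
theorem x1F_mem_FP : P.x1F Ad ∈ FP :=
  fanoutFn_mem_FP uN0_mem_FP (fanoutFn_mem_FP bF0_mem_FP (fanoutFn_mem_FP kF0_mem_FP (fanoutFn_mem_FP yF0_mem_FP sdF0_mem_FP)))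
/-- `candF0 ∈ FP` for polynomial-time `A`. [folklore] -/
theorem candF0_mem_FP (hA : Ad.A.IsPolyTime schemeEnc encodeBool) : P.candF0 Ad ∈ FP := comp_mem_FP (candFn_mem_FP hA) x1F_mem_FP
/-- `hitF ∈ FP` for polynomial-time `f` and `A`. [folklore] -/
theorem hitF_mem_FP (hf : P.f ∈ FP) (hA : Ad.A.IsPolyTime schemeEnc encodeBool) : P.hitF Ad ∈ FP :=
  comp_mem_FP eqPairFn_mem_FP (fanoutFn_mem_FP (comp_mem_FP hf (candF0_mem_FP hA)) yF0_mem_FP)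
/-- `guard0 ∈ FP`. [folklore] -/
theorem guard0_mem_FP : P.guard0 Ad ∈ FP :=
  andFn_mem_FP (comp_mem_FP (lenLeFn_mem_FP _) (fanoutFn_mem_FP (comp_mem_FP (polyFn_mem_FP _) uN0_mem_FP)
    (comp_mem_FP (cons_mem_FP true) jF0_mem_FP))) (comp_mem_FP isNilFn_mem_FP (nthF_mem_FP 2))
/-- `flNew ∈ FP`. [folklore] -/
theorem flNew_mem_FP (hf : P.f ∈ FP) (hA : Ad.A.IsPolyTime schemeEnc encodeBool) : P.flNew Ad ∈ FP :=
  iteFn_mem_FP guard0_mem_FP (iteFn_mem_FP (hitF_mem_FP hf hA) (const_mem_FP _) (nthF_mem_FP 2)) (nthF_mem_FP 2)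
/-- `ansNew ∈ FP`. [folklore] -/
theorem ansNew_mem_FP (hf : P.f ∈ FP) (hA : Ad.A.IsPolyTime schemeEnc encodeBool) : P.ansNew Ad ∈ FP :=
  iteFn_mem_FP guard0_mem_FP (iteFn_mem_FP (hitF_mem_FP hf hA) (candF0_mem_FP hA) (sndPow_mem_FP 2)) (sndPow_mem_FP 2)
/-- `obody ∈ FP`. [folklore] -/
theorem obody_mem_FP (hf : P.f ∈ FP) (hA : Ad.A.IsPolyTime schemeEnc encodeBool) : P.obody Ad ∈ FP :=
  fanoutFn_mem_FP fstF_mem_FP (fanoutFn_mem_FP (comp_mem_FP (cons_mem_FP true) jF0_mem_FP)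
    (fanoutFn_mem_FP (flNew_mem_FP hf hA) (ansNew_mem_FP hf hA)))
/-- `init0F ∈ FP`. [folklore] -/
theorem init0F_mem_FP : init0F ∈ FP :=
  fanoutFn_mem_FP (fanoutFn_mem_FP (comp_mem_FP onesFn_mem_FP (comp_mem_FP fstF_mem_FP fstF_mem_FP))
    (fanoutFn_mem_FP (comp_mem_FP sndF_mem_FP fstF_mem_FP) sndF_mem_FP)) (const_mem_FP _)

/-- **The run function is polynomial time** for polynomial-time `f` and `A`
(`iterate_mem_FP_of_growth_poly` on the run loop). [Bogdanov–Trevisan 2006, Claim 28 ("runs in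
time polynomial in `n` and `1/δ`"); Arora–Barak 2009, §1.4.1] [folklore] -/
theorem runFn_mem_FP (hf : P.f ∈ FP) (hA : Ad.A.IsPolyTime schemeEnc encodeBool) : P.runFn Ad ∈ FP :=
  comp_mem_FP (sndPow_mem_FP 2) (comp_mem_FP
    (iterate_mem_FP_of_growth_poly (obody_mem_FP hf hA) (P.oGrowth Ad) (fun S => fst_obody S)
      (fun S => length_obody_le S) (P.roundsPoly Ad)) init0F_mem_FP)

/-- The coin budget as a polynomial. [folklore] -/
theorem coinLen_eq (ℓ : ℕ) : P.coinLen Ad ℓ = (P.roundsPoly Ad * P.RnPoly Ad).eval ℓ := by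
  rw [eval_mul, eval_roundsPoly, eval_RnPoly]; rfl

/-- **The inverter is PPT** for polynomial-time `f` and `A` (the second efficiency hypothesis of
`not_isOneWay_of_subset_HeurBPP`): its run function is polynomial time on `⟨input, coins⟩` and its
coin budget is a polynomial. [Bogdanov–Trevisan 2006, Thm. 22 ("a probabilistic algorithm `I(y; δ)`
running in time polynomial in `n` and `1/δ`")] [cite: BogdanovTrevisan2006, Thm. 22 (ECCC TR06-073 §3.3)] -/
theorem inv_isPPT (hf : PolyTimeComputable (id : List Bool → List Bool) (id : List Bool → List Bool) P.f)
    (hA : Ad.A.IsPolyTime schemeEnc encodeBool) : IsPPT (P.inv Ad) id := by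
  refine ⟨?_, P.roundsPoly Ad * P.RnPoly Ad, fun ℓ => (coinLen_eq (P := P) (Ad := Ad) ℓ).le⟩
  obtain ⟨q, M, hM⟩ := runFn_mem_FP hf hA
  refine ⟨q, M, fun p => ?_⟩
  have h := hM (boolPair p.1 p.2)
  rw [show (id (P.runFn Ad (boolPair p.1 p.2)) : List Bool) = id (Function.uncurry (P.inv Ad).run p) by
    rw [runFn_boolPair]; rfl] at h
  exact h

end FP

end Params

/-! ### Bogdanov–Trevisan's Theorem 22 and crypto-foundations.S25, unconditionally -/

/-- **Bogdanov–Trevisan, Theorem 22** (ECCC TR06-073 §3.3; FnT TCS 2(1) §4.3; Impagliazzo–Levin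
1990): if `(NP, U) ⊆ HeurBPP` then no function is one-way. [Bogdanov–Trevisan 2006, Thm. 22]
[cite: BogdanovTrevisan2006, Thm. 22 (ECCC TR06-073 §3.3)] -/
theorem not_isOneWay_of_NP_uniform_subset_HeurBPP (hsub : distClass NP {MetaComplexity.uniformEnsemble} ⊆ HeurBPP)
    (f : List Bool → List Bool) : ¬ IsOneWay f :=
  not_isOneWay_of_subset_HeurBPP (fun _ hf => Params.Rel_mem_P hf) (fun _ _ hf hA => Params.inv_isPPT hf hA) hsub f

/-- **crypto-foundations.S25** (`OWF ⇒ (NP, U) ⊄ HeurBPP`), proved: the discharge term for the named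
fact `Literature.Computability.Cryptography.distClass_NP_uniform_not_subset_HeurBPP_of_OWFExist`.
[Bogdanov–Trevisan 2006, Thm. 22; Impagliazzo–Levin 1990] [cite: BogdanovTrevisan2006, Thm. 22 (ECCC TR06-073 §3.3)] -/
theorem OWFExist_imp_not_subset_HeurBPP : distClass_NP_uniform_not_subset_HeurBPP_of_OWFExist :=
  distClass_NP_uniform_not_subset_HeurBPP_of_OWFExist_of (fun _ hf => Params.Rel_mem_P hf)
    (fun _ _ hf hA => Params.inv_isPPT hf hA)

end ImpagliazzoLevin

end Literature.Computability.Cryptography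

namespace Literature.Computability.Cryptography

/-- **`distClass_NP_uniform_not_subset_HeurBPP_of_OWFExist` is a theorem of the tree (audit
alias).** The named fact `distClass_NP_uniform_not_subset_HeurBPP_of_OWFExist`
(`Sweep1.lean`): crypto-foundations.S25 (Bogdanov–Trevisan 2006, §4.3, Thm. 27 in the
numbering of arXiv:cs/0606037v2; contrapositive form). … — is proved outright by
`OWFExist_imp_not_subset_HeurBPP` (this file); this alias records the discharge under the
census/audit name `distClass_NP_uniform_not_subset_HeurBPP_of_OWFExist_holds` (librarian sweep
g25, pass 5c; no new mathematics).
[cite: BogdanovTrevisan2006, §4.3, Thm. 27 (arXiv:cs/0606037v2 numbering)] -/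
theorem distClass_NP_uniform_not_subset_HeurBPP_of_OWFExist_holds :
    distClass_NP_uniform_not_subset_HeurBPP_of_OWFExist :=
  Literature.Computability.Cryptography.ImpagliazzoLevin.OWFExist_imp_not_subset_HeurBPP

end Literature.Computability.Cryptography
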